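import Literature.Topology.Immersions.OpenParallelizableImmersionMorse
import Literature.Topology.Immersions.HolonomicApproxCubeAdapter
import HarnessLib

/-!
# Submersions of open parallelizable manifolds (Phillips 1967, Cor. 8.2 "if"): the discharge

Topic `Literature/Topology/Immersions`; discharges the named fact
`Literature.Topology.Immersions.Phillips1967_exists_isLocalDiffeomorph_of_isParallelizable`
("every open parallelizable manifold `Mⁿ` admits a `C^∞` map into `ℝⁿ` with everywhere
invertible differential") along the Gromov–Eliashberg–Mishachev route, assembled in
`OpenParallelizableImmersionMorse.lean`
(`Phillips1967_exists_isLocalDiffeomorph_of_isParallelizable_of_hasCubeCollarApprox`: reduction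
to dimension `≥ 2`, connected components, frames; the inductive engine over the sublevel sets of
a proper Morse function without critical points of index `n` — Phillips' Lemma 1.1 —; the
compression steps by isotopies and the extension steps over the cores of the handles, reduced to
holonomic approximation over cubes relative to a collar), the last input being supplied by the
explicit holonomic approximation theorem over the unit cube
(`HolonomicApprox.holonomic_approx_cube`, Eliashberg–Mishachev 2002, Thm. 3.1.2, via
`hasCubeCollarApprox`).

## References

* A. Phillips, *Submersions of open manifolds*, Topology **6** (1967), 171–206, Cor. 8.2,
  Thm. B, §§1–8. [Phillips1967]
* Y. Eliashberg, N. Mishachev, *Introduction to the h-principle*, GSM 48 (2002), Thm. 3.1.1,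
  3.1.2, 4.?; *Holonomic approximation and Gromov's h-principle*, arXiv:math/0101196 (2001).
  [EliashbergMishachev2001]
* M. Gromov, *Partial differential relations* (1986), 2.2.1.
-/

noncomputable section

namespace Literature.Topology.Immersions

/-- **Phillips 1967, Cor. 8.2 ("if")**: an open parallelizable `C^∞` manifold `Mⁿ` admits a
`C^∞` local diffeomorphism into `ℝⁿ`. Discharge of the named fact
`Phillips1967_exists_isLocalDiffeomorph_of_isParallelizable`. [cite: Phillips1967, Cor. 8.2] -/
theorem Phillips1967_exists_isLocalDiffeomorph_of_isParallelizable_holds :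
    Phillips1967_exists_isLocalDiffeomorph_of_isParallelizable :=
  Phillips1967_exists_isLocalDiffeomorph_of_isParallelizable_of_hasCubeCollarApprox
    fun n _k _ hkn => hasCubeCollarApprox (n := n) hkn

end Literature.Topology.Immersions
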